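import Mathlib
import Summits.Ventures.PercRepro2.CoinCoreGate
import Summits.Ventures.PercRepro2.CoinOrTailKDefs
import Summits.Ventures.PercRepro2.CoinOrTailKSums
import Summits.Ventures.PercRepro2.CoinOrTailKCore
import Summits.Ventures.PercRepro2.CoinKSureTailSums
import Summits.Ventures.PercRepro2.CoinChainTower
import Summits.Ventures.PercRepro2.CoinTowerFunnelCoins

/-!
# The funnel at a CORE vertex: the markers `(m, a)` when every route into `a` passes through `m`
(blind cell PercRepro2, night-2 g18; proofs/NIGHT2-DARC.md §58.12)

An OR-tower over ANY closed-in core `U` with the free-arc vertex `a` on top, ANY coins, whose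
every entry is the core vertex `m` or a tower vertex — every route into `a` passes through `m`.
Markers `(m, a)`: the level reduction over `a` splits the laws into their non-entered and entered
parts, the tower transports them (`sum_tower`, `towerVal_linear`), the marker `1[m ∈ W]` is `1`
wherever the entered parts are nonzero, and `nested_weighted_nonneg` closes — no closure, no
log-supermodularity, no sure coin anywhere: **`darc_of_funnelCore`**.  The one-entry OR-tail
`a` entered from `m` alone (`up = []`, `ent = {m}`) is the smallest case.
-/

namespace Summit.Ventures.PercRepro2.Coin

open Classical

section FunnelCore

variable {V : Type*} {E : Type*} [Fintype V] [DecidableEq V] [Fintype E] [DecidableEq E]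
  {R : Type*} [Field R] [LinearOrder R] [IsStrictOrderedRing R]
  {arcs : E → Finset (V × V)} {s : V} {U : Finset V} {ent : Finset V} {c : V → E}
  {a w : V} {up : List (Finset V × (V → E) × V)}

/-- **THEOREM (the funnel at a core vertex, ANY coins, ANY core).** `up` an OR-tower over a
closed-in core `U` and `a` an OR-vertex of its core, ANY coins, every entry of every level and of
`a` equal to `m ∈ U` or outside `U`; `t, w ∉ insert a (towerCore U up)`, `t, w ≠ s` ⟹
`DARC pr arcs s {t} m a a w`. -/
theorem darc_of_funnelCore (pr : E → R) (hp : IsProbVec pr) (hS : SameEnds arcs)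
    (hup : OrTower arcs s U up) (h : OrTailK arcs s (towerCore U up) ent c a)
    {m : V} (hm : m ∈ U)
    (hcovL : ∀ x ∈ up, ∀ r ∈ x.1, r = m ∨ r ∉ U) (hcov : ∀ r ∈ ent, r = m ∨ r ∉ U)
    {t : V} (htC : t ∉ insert a (towerCore U up)) (hts : t ≠ s)
    (hws : w ≠ s) (hwC : w ∉ insert a (towerCore U up)) :
    DARC pr arcs s {t} m a a w := by
  have hC := h.closedInCoreU
  have hUT : U ⊆ towerCore U up := subset_towerCore U up
  have haC' : a ∉ towerCore U up := h.a_notin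
  have hma : m ≠ a := fun e => haC' (e ▸ hUT hm)
  have hvert := hup.vertex_notin
  have hmv : ∀ x ∈ up, m ≠ x.2.2 := fun x hx e => hvert x hx (e ▸ hm)
  have hmC : m ∈ insert a (towerCore U up) := Finset.mem_insert_of_mem (hUT hm)
  have haC : a ∈ insert a (towerCore U up) := Finset.mem_insert_self _ _
  unfold DARC
  rw [hC.phiC_gate_eq pr hS htC hts hmC haC haC hws hwC]
  -- the marker functions and their invariances
  have hm1 : ∀ W : Finset V, (fun _ : Finset V => (1 : R)) (insert a W) = (fun _ => (1 : R)) W :=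
    fun _ => rfl
  have hm1L : ∀ x ∈ up, ∀ W : Finset V, (fun _ : Finset V => (1 : R)) (insert x.2.2 W) =
    (fun _ => (1 : R)) W := fun _ _ _ => rfl
  have hxa : ∀ W : Finset V, (fun W : Finset V => if m ∈ W then (1 : R) else 0) (insert a W) =
      (fun W : Finset V => if m ∈ W then (1 : R) else 0) W := by
    intro W; simp only [Finset.mem_insert, hma, false_or]
  have hxL : ∀ x ∈ up, ∀ W : Finset V,
      (fun W : Finset V => if m ∈ W then (1 : R) else 0) (insert x.2.2 W) =
      (fun W : Finset V => if m ∈ W then (1 : R) else 0) W := by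
    intro x hx W; simp only [Finset.mem_insert, hmv x hx, false_or]
  have hg0 : ∀ W : Finset V, a ∉ W → (fun W : Finset V => if a ∈ W then (1 : R) else 0) W = 0 :=
    by intro W hW; simp only [hW, if_false]
  have hg1 : ∀ W : Finset V, a ∉ W →
      (fun W : Finset V => if a ∈ W then (1 : R) else 0) (insert a W) = (fun _ => (1 : R)) W := by
    intro W _; simp only [Finset.mem_insert_self, if_true]
  have hq0 : ∀ W : Finset V, a ∉ W →
      (fun W : Finset V => (if m ∈ W then (1 : R) else 0) * (if a ∈ W then (1 : R) else 0)) W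
        = 0 := by intro W hW; simp only [hW, if_false, mul_zero]
  have hq1 : ∀ W : Finset V, a ∉ W →
      (fun W : Finset V => (if m ∈ W then (1 : R) else 0) * (if a ∈ W then (1 : R) else 0))
          (insert a W) =
        (fun W : Finset V => if m ∈ W then (1 : R) else 0) W := by
    intro W _
    simp only [Finset.mem_insert_self, if_true, mul_one, Finset.mem_insert, hma, false_or]
  -- the level reduction over `a`
  have eΛ := h.sum_R_eq pr t (fun _ => (1 : R)) hm1
  have eFa := h.sum_R_eq pr t (fun W => if m ∈ W then (1 : R) else 0) hxa
  have eFb := h.sum_R_eq_tail pr t (fun W => if a ∈ W then (1 : R) else 0) (fun _ => (1 : R))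
    hg0 hg1
  have eM := h.sum_G_eq (w := w) pr t (fun _ => (1 : R)) hm1
  have eX := h.sum_G_eq (w := w) pr t (fun W => if m ∈ W then (1 : R) else 0) hxa
  have eY := h.sum_G_eq_tail (w := w) pr t (fun W => if a ∈ W then (1 : R) else 0)
    (fun _ => (1 : R)) hg0 hg1
  have eXY := h.sum_G_eq_tail (w := w) pr t
    (fun W => (if m ∈ W then (1 : R) else 0) * (if a ∈ W then (1 : R) else 0))
    (fun W => if m ∈ W then (1 : R) else 0) hq0 hq1
  simp only [mul_one] at eΛ eFb eM eY
  rw [eΛ, eFa, eFb, eM, eX, eY, eXY]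
  set A : Finset V → R := fun X => prob pr (coreAvoidEvent arcs s t (insert a (towerCore U up)) X)
    with hAdef
  obtain ⟨hA0, -, -⟩ := OrTailU.head_props (U := towerCore U up) (a := a) pr hp hS t
  have hp0 := hp.nonneg; have hp1 := hp.le_one
  set FR : Finset V → R := rValK A pr ent c a with hFR
  set FG : Finset V → R := gValK A pr ent c a w with hFG
  set FRa : Finset V → R := rValKa A pr ent c a with hFRa
  set FGa : Finset V → R := gValKa A pr ent c a w with hFGa
  -- the tower
  have tΛ := hup.sum_tower pr FR (fun _ => (1 : R)) hm1L
  have tFa := hup.sum_tower pr FR (fun W => if m ∈ W then (1 : R) else 0) hxL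
  have tFb := hup.sum_tower pr FRa (fun _ => (1 : R)) hm1L
  have tM := hup.sum_tower pr FG (fun _ => (1 : R)) hm1L
  have tX := hup.sum_tower pr FG (fun W => if m ∈ W then (1 : R) else 0) hxL
  have tY := hup.sum_tower pr FGa (fun _ => (1 : R)) hm1L
  have tXY := hup.sum_tower pr FGa (fun W => if m ∈ W then (1 : R) else 0) hxL
  simp only [mul_one] at tΛ tFb tM tY
  rw [tΛ, tFa, tFb, tM, tX, tY, tXY]
  set TR : Finset V → R := towerVal pr up FR with hTR
  set TG : Finset V → R := towerVal pr up FG with hTG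
  set TRa : Finset V → R := towerVal pr up FRa with hTRa
  set TGa : Finset V → R := towerVal pr up FGa with hTGa
  -- the weighted nested functional on `U`
  have hν0 : ∀ W, 0 ≤ prob pr (coreLevel arcs s U W) := fun W => prob_nonneg hp _
  have hFR0 : ∀ W, 0 ≤ FR W := fun W => rValK_nonneg hp0 hp1 hA0 ent c a W
  have hFGa0 : ∀ W, 0 ≤ FGa W := fun W => gValKa_nonneg A pr hp0 hp1 hA0 ent c a w W
  have hTR0 : ∀ W, 0 ≤ TR W := towerVal_nonneg pr hp0 hp1 up FR hFR0
  have hTGa0 : ∀ W, 0 ≤ TGa W := towerVal_nonneg pr hp0 hp1 up FGa hFGa0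
  have hTRale : ∀ W, TRa W ≤ TR W :=
    towerVal_head_le pr hp0 hp1 up (fun W => rValKa_le_rValK A pr hp1 hA0 ent c a W)
  have hTGeq : ∀ W, TG W = TR W - TRa W + TGa W := by
    intro W
    have hFGeq : FG = fun X => FR X - FRa X + FGa X :=
      funext fun X => gValK_eq_rValK_sub_add A pr ent c a w X
    simp only [hTG, hTR, hTRa, hTGa]
    rw [hFGeq]
    exact towerVal_linear pr up FR FRa FGa W
  have hzero : ∀ W ⊆ U, m ∉ W → TRa W = 0 ∧ TGa W = 0 := by
    intro W hW hmW
    have hnoL : ∀ z ∈ up, ∀ r ∈ z.1, r ∉ W := by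
      intro z hz r hr hrW
      rcases hcovL z hz r hr with rfl | hrU
      · exact hmW hrW
      · exact hrU (hW hrW)
    have hno : ∀ r ∈ ent, r ∉ W := by
      intro r hr hrW
      rcases hcov r hr with rfl | hrU
      · exact hmW hrW
      · exact hrU (hW hrW)
    simp only [hTRa, hTGa]
    rw [towerVal_of_no_entry pr up FRa hnoL, towerVal_of_no_entry pr up FGa hnoL]
    simp only [hFRa, hFGa]
    exact ⟨rValKa_eq_zero_of_no_entry A pr c a hno, gValKa_eq_zero_of_no_entry A pr c a w hno⟩
  refine nested_weighted_nonneg U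
    (fun W => prob pr (coreLevel arcs s U W) * TR W)
    (fun W => prob pr (coreLevel arcs s U W) * TG W)
    (fun W => prob pr (coreLevel arcs s U W) * TRa W)
    (fun W => prob pr (coreLevel arcs s U W) * TGa W)
    (fun W => if m ∈ W then (1 : R) else 0)
    (fun W => mul_nonneg (hν0 W) (hTR0 _)) (fun W => mul_nonneg (hν0 W) (hTGa0 _))
    (fun W => mul_le_mul_of_nonneg_left (hTRale _) (hν0 W))
    (fun W => by rw [hTGeq]; ring) (fun W => by split_ifs <;> simp) ?_ ?_
  · intro W hW
    by_cases hmW : m ∈ W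
    · rw [if_pos hmW, one_mul]
    · rw [if_neg hmW, zero_mul, (hzero W (Finset.mem_powerset.1 hW) hmW).1, mul_zero]
  · intro W hW
    by_cases hmW : m ∈ W
    · rw [if_pos hmW, one_mul]
    · rw [if_neg hmW, zero_mul, (hzero W (Finset.mem_powerset.1 hW) hmW).2, mul_zero]

/-- **The smallest case: an OR-vertex `a` entered from the core vertex `m` alone, any coin, ANY
core — the markers `(m, a)`.** -/
theorem darc_of_oneEntry_markerMA (pr : E → R) (hp : IsProbVec pr) (hS : SameEnds arcs)
    {m : V} (h : OrTailK arcs s U {m} c a) (hm : m ∈ U)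
    {t : V} (htC : t ∉ insert a U) (hts : t ≠ s) (hws : w ≠ s) (hwC : w ∉ insert a U) :
    DARC pr arcs s {t} m a a w :=
  darc_of_funnelCore pr hp hS (OrTower.nil U) h hm (fun _ hx => absurd hx List.not_mem_nil)
    (fun _ hr => Or.inl (Finset.mem_singleton.1 hr)) htC hts hws hwC

end FunnelCore

end Summit.Ventures.PercRepro2.Coin
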